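import Summits.BirchSwinnertonDyer.BirchSwinnertonDyer.Theorems.ClassRecordThreeCornerAtThreeShimuraSwapFamilyStep
import HarnessLib

/-!
# PORT-SPEC (P1), file 4: LEVEL RAISING AT MINIMAL DEPTH for an ARBITRARY FAMILY `ys : (m : ℕ) → E(K[m])` of points over the
# ring class fields (McCallum 1991 Prop. 5.2, `C = {0}`; the walk assembled over an abstract prime pool `KP` and target `Fine`) —
# family twin of bsd-jet pv-2's `Swap.exists_conductor_levelIndex_ge_of_minDepth` and of this seat's `…_of_irreducible`
# (cell `bsd-stepL`, seat `bsd-stepL-corner-p1` g15; `--supports stmt-BirchSwinnertonDyer-21420 --as helper`)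

WHAT. `Swap.exists_conductor_fine_of_minDepth_family`: for `K` imaginary quadratic with the non-trivial `τ` (`τ² = 1`), `p` odd, the
level-`p` Poitou–Tate package ∕ Weil datum ∕ transverse family `𝒯` with the walk's local inputs (`h𝒯σ`, `h𝒯sd`, `hloc`, `hdisj`),
`E(K)[p] = 0` (`hbot`), a prime POOL `KP` inside W. Zhang's Kolyvagin primes of index `≥ 1 + u` (`hKP`) and a TARGET predicate
`Fine`, a Čebotarev supply landing in `KP ∩ Fine` (`hceb`; McCallum Cor. 3.2 ∕ Jetchev Lemma 5.1 — KERNEL for `ρ̄` onto, for `E[p]`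
irreducible with `−1 ∈ ρ̄(Γ_ℚ)`, and at `3`: `…WalkCebotarev`, `…KolyJWalkCebotarev`, `…CebotarevOfImageOdd`), and the FAMILY
DICTIONARY on the pool-conductors (square-free `m` with all prime factors in `KP`), stated for EVERY family datum `d` with
`d.y = ys m` (every presentation `(σ, S, emb)`): existence of a presentation (`hdata`), the standing inputs (`hA` admissibility,
`hP` invariance of `[P_m]` mod `p^{1+u}` — Gross 4.3 ∕ 3.6), the `τ`-sign `τ_* c_{1+u}(m) = ε·(−1)^{#m} • c_{1+u}(m)` (`hsign` — Gross
5.3–5.4 ∕ label (B3)), the Selmer membership of the level-`p` root classes (`hsel` — Gross 6.2 (1), McCallum 4.3, [GZ86 III (3.1)] ∕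
label (B6)), McCallum Prop. 4.4 for ANY two presentations at `m ∣ mℓ` (`h44` — Gross 3.7 ∕ labels (B4)+(B5)), and MINIMALITY of
the depth `u` (`hmin`: every pool-conductor's derived point is `p^u`-divisible): from ANY pool-conductor `n₀` and presentation `d₀`
with `p^{u+1} ∤ P(d₀)`, there is a pool-conductor `n` ALL of whose prime factors are `Fine`, with a presentation `d` and
`p^{u+1} ∤ P(d)`. PROOF: the walk `Swap.exists_forall_fine_of_swapStep` (file 1) with the invariant «square-free, pool, some
presentation with `p^{u+1} ∤ P`», one step = brick 2a (`exists_swapPrime_family`, target `KP ∩ Fine`) + presentations at `nℓ'` and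
`nℓ'/ℓ₀` from `hdata` + brick 2b (`not_dvd_of_swap_family`) fed by the dictionary (the `λ₀`-instance of Prop. 4.4 through the
`subst` adapter `addOrderOf_localization_kolyvaginClass_eq_of_family_cast`). Instances: `KP q := Zhang-Kolyvagin ∧ 1 + u ≤ M(q)`,
`Fine q := m' ≤ M(q)` recovers the `hswap` shape of tam3-p1's `KolyvaginFamilyData.pDiv_of_swap_of_perLevel`; `KP q :=
Gross-Kolyvagin ∧ 1 + u ≤ depth(q)`, `Fine q := e ≤ depth(q)` (Gross (3.2) depth) is the shape of corner3-p2's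
`ShimuraWalk.SwapSupplyAt` modulo the presentation transfer `d.PDiv ↔ ShimuraWalk.PDiv` (Gross Prop. 3.6; lane corner3-p2 g8 (a)).
HONEST FRAMING: two theorems, no definition ∕ fact ∕ sorry; CONDITIONAL on every displayed input; the dictionary is NOT supplied
here for any family; nothing about any curve; no stub ∕ item closes; BSD is not proved by any of this; T7. Credit: bsd-jet pv-2.
References (locators only): [cite: McCallumLMS1991, §5 Prop. 5.2 and proof (pp. 304–306), §4 Prop. 4.4] [cite: Jetchev2008, proof
of Thm. 1.4 (p. 824), Lemma 5.1] [cite: GrossLMS1991, §3 (3.2), Prop. 3.6, Prop. 3.7, Prop. 5.4, Prop. 6.2] [cite: BurungaleEtAl2026, Prop. 2.2.1].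
presearch: not applicable (re-keying of tree theorems). Design: no definitions; `K : Type`. Axioms: `propext`, `Classical.choice`, `Quot.sound`.
-/

set_option autoImplicit false

noncomputable section

open scoped Classical Pointwise
open Function NumberField IsDedekindDomain WeierstrassCurve Field
open Literature.NumberTheory.EllipticCurves Literature.NumberTheory.GaloisRepresentations
open Literature.NumberTheory.EllipticCurves.Jetchev2008 Literature.NumberTheory.EllipticCurves.KolyvaginCocycle
open Literature.NumberTheory.EllipticCurves.ModularForms
open Literature.NumberTheory.GaloisCohomology Literature.NumberTheory.Automorphic
open Literature.NumberTheory.GaloisRepresentations.DiscreteGaloisModule (transverseSubgroup SelmerStructure)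
open Summit.BirchSwinnertonDyer.Rank1Residual.JET.SelmerVocabulary
open Summit.BirchSwinnertonDyer.Rank1Residual.JET.GlobalDuality
open Summit.BirchSwinnertonDyer.Rank1Residual.X11b
open Summit.BirchSwinnertonDyer.Rank1Residual.X11b.Three
open Summit.BirchSwinnertonDyer.BirchSwinnertonDyer.Theorems

namespace Summit.BirchSwinnertonDyer.Rank1Residual.JET.Swap

variable {K : Type} [Field K] [NumberField K] (W : WeierstrassCurve ℚ) [W.IsElliptic]
  [W.IsGloballyMinimal]

omit [W.IsElliptic] [W.IsGloballyMinimal] in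
/-- **McCallum Prop. 4.4 for family data, conductor of the top datum given by an equation** (`m * l = N`): the ANY-two-
presentations hypothesis `h44` of the walk transported along `subst` — the family form of bsd-jet's `…_of_prop44_cast`.
[cite: McCallumLMS1991, §4 Prop. 4.4 (p. 301)] -/
theorem addOrderOf_localization_kolyvaginClass_eq_of_family_cast (p : ℕ) [Fact p.Prime] {ι : K →+* ℂ}
    (ys : (m : ℕ) → (W.baseChange (ringClassField K ι m)).toAffine.Point) (KP : ℕ → Prop) (M : ℕ)
    (h44 : ∀ (m l : ℕ), Squarefree (m * l) → l.Prime → ¬ l ∣ m → (∀ q ∈ (m * l).primeFactors, KP q) →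
      ∀ (dm : KolyvaginFamilyData W K ι m) (dml : KolyvaginFamilyData W K ι (m * l)),
      dm.y = ys m → dml.y = ys (m * l) →
      ∀ (v : HeightOneSpectrum (𝓞 K)), (l : 𝓞 K) ∈ v.asIdeal →
      addOrderOf ((galoisCohomology.localization
          ((W.baseChange K).torsionGaloisModule ((p ^ M : ℕ) : ℤ)) (Sum.inr v) 1 :
            galH1Torsion (W.baseChange K) ((p ^ M : ℕ) : ℤ) →+ _)
          (dml.kolyvaginClass (Fact.out : p.Prime) M)) =
        addOrderOf ((galoisCohomology.localization
          ((W.baseChange K).torsionGaloisModule ((p ^ M : ℕ) : ℤ)) (Sum.inr v) 1 :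
            galH1Torsion (W.baseChange K) ((p ^ M : ℕ) : ℤ) →+ _)
          (dm.kolyvaginClass (Fact.out : p.Prime) M)))
    {m l N : ℕ} (hN : m * l = N) (hml : Squarefree N) (hl : l.Prime) (hlm : ¬ l ∣ m)
    (hK' : ∀ q ∈ N.primeFactors, KP q)
    (dm : KolyvaginFamilyData W K ι m) (dN : KolyvaginFamilyData W K ι N) (hdm : dm.y = ys m) (hdN : dN.y = ys N)
    (v : HeightOneSpectrum (𝓞 K)) (hv : (l : 𝓞 K) ∈ v.asIdeal) :
    addOrderOf ((galoisCohomology.localization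
        ((W.baseChange K).torsionGaloisModule ((p ^ M : ℕ) : ℤ)) (Sum.inr v) 1 :
          galH1Torsion (W.baseChange K) ((p ^ M : ℕ) : ℤ) →+ _)
        (dN.kolyvaginClass (Fact.out : p.Prime) M)) =
      addOrderOf ((galoisCohomology.localization
        ((W.baseChange K).torsionGaloisModule ((p ^ M : ℕ) : ℤ)) (Sum.inr v) 1 :
          galH1Torsion (W.baseChange K) ((p ^ M : ℕ) : ℤ) →+ _)
        (dm.kolyvaginClass (Fact.out : p.Prime) M)) := by
  subst hN
  exact h44 m l hml hl hlm hK' dm dN hdm hdN v hv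

section Prime

variable (τ : K ≃ₐ[ℚ] K) (p : ℕ) [Fact p.Prime] [NeZero (p ^ 1)]
  [Finite (geomTorsion (W.baseChange K) ((p ^ 1 : ℕ) : ℤ))]
  (e : geomTorsion (W.baseChange K) ((p ^ 1 : ℕ) : ℤ) → geomTorsion (W.baseChange K) ((p ^ 1 : ℕ) : ℤ) →
    AlgebraicClosure K)
  (hμ : ∀ S T, e S T ^ (p ^ 1) = 1)
  (hadd₁ : ∀ S₁ S₂ T, e (S₁ + S₂) T = e S₁ T * e S₂ T)
  (hadd₂ : ∀ S T₁ T₂, e S (T₁ + T₂) = e S T₁ * e S T₂)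
  (hgal : ∀ (g : absoluteGaloisGroup K) (S T : geomTorsion (W.baseChange K) ((p ^ 1 : ℕ) : ℤ)),
    g • e S T = e (g • S) (g • T))
  (halt : ∀ T, e T T = 1) (hnondeg : ∀ T, (∀ S, e S T = 1) → T = 0)
  (hτe : ∀ S T, liftAut τ (e S T) =
    e ((isLiftOfAut_liftAut τ).torsionMap W ((p ^ 1 : ℕ) : ℤ) S)
      ((isLiftOfAut_liftAut τ).torsionMap W ((p ^ 1 : ℕ) : ℤ) T))

include halt hnondeg hτe in
/-- **LEVEL RAISING AT MINIMAL DEPTH for an arbitrary family of points over the ring class fields** — McCallum 1991 Prop. 5.2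
(`C = {0}`) over the prime pool `KP` with target `Fine`, PROVED modulo the displayed curve-side inputs and the displayed family
dictionary (see the module docstring). [cite: McCallumLMS1991, §5 Prop. 5.2 and proof (pp. 304–306)] [cite: Jetchev2008, proof of Thm. 1.4 (p. 824)] -/
theorem exists_conductor_fine_of_minDepth_family (hK : IsImaginaryQuadratic K) (hp2 : p ≠ 2) (hττ : τ * τ = 1)
    {ι : K →+* ℂ} (ys : (m : ℕ) → (W.baseChange (ringClassField K ι m)).toAffine.Point)
    (inv : LocalInvariants K (p ^ 1)) (hperf : inv.IsPerfect) (hvan : inv.SumLocalTermEqZero)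
    (hSC : inv.SelmerComplement) (hinv : inv.IsConjCompatible τ)
    (𝒯 : SelmerStructure ((W.baseChange K).torsionGaloisModule ((p ^ 1 : ℕ) : ℤ)))
    (h𝒯σ : ∀ (c : ℕ), Squarefree c →
      (∀ q ∈ c.primeFactors, Zhang2014.IsKolyvaginPrime (W.conductorNorm ℤ) W K p q) →
      ∀ (v w : HeightOneSpectrum (𝓞 K)) (h : τ • v = w), v ∈ placesDividing K c →
      ∀ x : galoisCohomology (((W.baseChange K).torsionGaloisModule ((p ^ 1 : ℕ) : ℤ)).toLocal
        (Sum.inr v : Place K)) 1,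
      x ∈ 𝒯 (Sum.inr v) → conjActPlace W τ ((p ^ 1 : ℕ) : ℤ) h x ∈ 𝒯 (Sum.inr w))
    (h𝒯sd : ∀ (c : ℕ), Squarefree c →
      (∀ q ∈ c.primeFactors, Zhang2014.IsKolyvaginPrime (W.conductorNorm ℤ) W K p q) →
      ∀ v ∈ placesDividing K c,
      inv.dualTransported 𝒯 (weilDualIntertwining (W.baseChange K) (p ^ 1) e hμ hadd₁ hadd₂ hgal)
        (Sum.inr v) = 𝒯 (Sum.inr v))
    (hloc : ∀ ℓ : ℕ, Zhang2014.IsKolyvaginPrime (W.conductorNorm ℤ) W K p ℓ →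
      1 ≤ Zhang2014.kolyvaginIndex W p ℓ →
      ∀ (v : HeightOneSpectrum (𝓞 K)), (ℓ : 𝓞 K) ∈ v.asIdeal → ∀ (hfix : τ • v = v) (s : ℤ),
      (s = 1 ∨ s = -1) →
      ((W.baseChange K).kummerSelmerStructure ((p ^ 1 : ℕ) : ℤ) (Sum.inr v)).relIndex
        ((conjActPlace W τ ((p ^ 1 : ℕ) : ℤ) hfix - s • AddMonoidHom.id _).ker) = p ^ 1)
    (hdisj : ∀ ℓ : ℕ, Zhang2014.IsKolyvaginPrime (W.conductorNorm ℤ) W K p ℓ →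
      ∀ v : HeightOneSpectrum (𝓞 K), (ℓ : 𝓞 K) ∈ v.asIdeal →
      Disjoint ((W.baseChange K).kummerSelmerStructure ((p ^ 1 : ℕ) : ℤ) (Sum.inr v)) (𝒯 (Sum.inr v)))
    (hbot : AddSubgroup.torsionBy (W.baseChange K).toAffine.Point (p : ℤ) = ⊥)
    -- the prime POOL (inside W. Zhang's Kolyvagin primes of index `≥ 1 + u`) and the TARGET
    {u : ℕ} (KP Fine : ℕ → Prop)
    (hKP : ∀ q, KP q → Zhang2014.IsKolyvaginPrime (W.conductorNorm ℤ) W K p q ∧ 1 + u ≤ Zhang2014.kolyvaginIndex W p q)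
    (hceb : ∀ (e₁ : ℤ), (e₁ = 1 ∨ e₁ = -1) →
      ∀ (x y : galoisCohomology ((W.baseChange K).torsionGaloisModule ((p ^ 1 : ℕ) : ℤ)) 1),
      conjAct W τ ((p ^ 1 : ℕ) : ℤ) x = e₁ • x → conjAct W τ ((p ^ 1 : ℕ) : ℤ) y = (-e₁) • y → y ≠ 0 →
      ∀ (b : ℕ), ∃ ℓ : ℕ, b < ℓ ∧ KP ℓ ∧ Fine ℓ ∧
        ∀ v : HeightOneSpectrum (𝓞 K), (ℓ : 𝓞 K) ∈ v.asIdeal →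
          addOrderOf (galoisCohomology.localization
              ((W.baseChange K).torsionGaloisModule ((p ^ 1 : ℕ) : ℤ)) (Sum.inr v) 1 x) = addOrderOf x ∧
          addOrderOf (galoisCohomology.localization
              ((W.baseChange K).torsionGaloisModule ((p ^ 1 : ℕ) : ℤ)) (Sum.inr v) 1 y) = addOrderOf y)
    -- the FAMILY DICTIONARY on the pool-conductors, for every presentation
    (hdata : ∀ (m : ℕ), Squarefree m → (∀ q ∈ m.primeFactors, KP q) →
      ∃ dm : KolyvaginFamilyData W K ι m, dm.y = ys m)
    (hA : ∀ (m : ℕ) (dm : KolyvaginFamilyData W K ι m), dm.y = ys m → Squarefree m → (∀ q ∈ m.primeFactors, KP q) →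
      IsAdmissible (absoluteGaloisGroup K) dm.pointsSubgroup ((p ^ (1 + u) : ℕ) : ℤ))
    (hP : ∀ (m : ℕ) (dm : KolyvaginFamilyData W K ι m), dm.y = ys m → Squarefree m → (∀ q ∈ m.primeFactors, KP q) →
      dm.toGeomPoints dm.derivedPoint ∈ invPoints (absoluteGaloisGroup K) dm.pointsSubgroup ((p ^ (1 + u) : ℕ) : ℤ))
    {εf : ℤ} (hεf : εf = 1 ∨ εf = -1)
    (hsign : ∀ (m : ℕ) (dm : KolyvaginFamilyData W K ι m), dm.y = ys m → Squarefree m → (∀ q ∈ m.primeFactors, KP q) →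
      conjAct W τ ((p ^ (1 + u) : ℕ) : ℤ) (dm.kolyvaginClass (Fact.out : p.Prime) (1 + u)) =
        (εf * (-1) ^ m.primeFactors.card) • dm.kolyvaginClass (Fact.out : p.Prime) (1 + u))
    (hsel : ∀ (m : ℕ) (dm : KolyvaginFamilyData W K ι m), dm.y = ys m → Squarefree m → (∀ q ∈ m.primeFactors, KP q) →
      ∀ (Q : (W.baseChange (ringClassField K ι m)).toAffine.Point)
      (hA1 : IsAdmissible (absoluteGaloisGroup K) dm.pointsSubgroup ((p ^ 1 : ℕ) : ℤ))
      (hQ : dm.toGeomPoints Q ∈ invPoints (absoluteGaloisGroup K) dm.pointsSubgroup ((p ^ 1 : ℕ) : ℤ)),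
      ((p ^ u : ℕ) : ℤ) • Q = dm.derivedPoint →
      kolyvaginClass (W.baseChange K) ((p ^ 1 : ℕ) : ℤ)
          ((W.baseChange K).zsmul_geomPoints_surjective_of_charZero
            (by exact_mod_cast pow_ne_zero 1 (Fact.out : p.Prime).ne_zero)) hA1 (dm.toGeomPoints Q) hQ ∈
        (selmerF W ((p ^ 1 : ℕ) : ℤ) 𝒯 (placesDividing K m)).selmerGroup)
    (h44 : ∀ (m l : ℕ), Squarefree (m * l) → l.Prime → ¬ l ∣ m → (∀ q ∈ (m * l).primeFactors, KP q) →
      ∀ (dm : KolyvaginFamilyData W K ι m) (dml : KolyvaginFamilyData W K ι (m * l)),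
      dm.y = ys m → dml.y = ys (m * l) →
      ∀ (v : HeightOneSpectrum (𝓞 K)), (l : 𝓞 K) ∈ v.asIdeal →
      addOrderOf ((galoisCohomology.localization
          ((W.baseChange K).torsionGaloisModule ((p ^ (1 + u) : ℕ) : ℤ)) (Sum.inr v) 1 :
            galH1Torsion (W.baseChange K) ((p ^ (1 + u) : ℕ) : ℤ) →+ _)
          (dml.kolyvaginClass (Fact.out : p.Prime) (1 + u))) =
        addOrderOf ((galoisCohomology.localization
          ((W.baseChange K).torsionGaloisModule ((p ^ (1 + u) : ℕ) : ℤ)) (Sum.inr v) 1 :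
            galH1Torsion (W.baseChange K) ((p ^ (1 + u) : ℕ) : ℤ) →+ _)
          (dm.kolyvaginClass (Fact.out : p.Prime) (1 + u))))
    (hmin : ∀ (m : ℕ) (dm : KolyvaginFamilyData W K ι m), dm.y = ys m → Squarefree m → (∀ q ∈ m.primeFactors, KP q) →
      ∃ Q : (W.baseChange (ringClassField K ι m)).toAffine.Point, ((p ^ u : ℕ) : ℤ) • Q = dm.derivedPoint)
    -- the start
    {n₀ : ℕ} (hn₀ : Squarefree n₀) (hn₀K : ∀ q ∈ n₀.primeFactors, KP q)
    (d₀ : KolyvaginFamilyData W K ι n₀) (hd₀y : d₀.y = ys n₀)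
    (hd₀ : ¬ ∃ Q : (W.baseChange (ringClassField K ι n₀)).toAffine.Point,
      ((p ^ (u + 1) : ℕ) : ℤ) • Q = d₀.derivedPoint) :
    ∃ (n : ℕ) (d : KolyvaginFamilyData W K ι n), d.y = ys n ∧ Squarefree n ∧
      (∀ q ∈ n.primeFactors, KP q ∧ Fine q) ∧
      ¬ ∃ Q : (W.baseChange (ringClassField K ι n)).toAffine.Point,
        ((p ^ (u + 1) : ℕ) : ℤ) • Q = d.derivedPoint := by
  have hp : p.Prime := Fact.out
  -- the invariant of the walk
  let Good : ℕ → Prop := fun n ↦ Squarefree n ∧ (∀ q ∈ n.primeFactors, KP q) ∧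
    ∃ d : KolyvaginFamilyData W K ι n, d.y = ys n ∧
      ¬ ∃ Q : (W.baseChange (ringClassField K ι n)).toAffine.Point, ((p ^ (u + 1) : ℕ) : ℤ) • Q = d.derivedPoint
  -- the sign bookkeeping
  have hsgn : ∀ n : ℕ, (εf * (-1) ^ n.primeFactors.card = 1 ∨ εf * (-1) ^ n.primeFactors.card = -1) :=
    sign_mul_neg_one_pow_card_eq_one_or hεf
  -- ONE SWAP
  have hstep : ∀ n, Good n → ∀ ℓ₀ ∈ n.primeFactors, ¬ Fine ℓ₀ →
      ∃ ℓ' : ℕ, ℓ'.Prime ∧ ℓ' ∉ n.primeFactors ∧ Fine ℓ' ∧ Good (n / ℓ₀ * ℓ') := by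
    rintro n ⟨hn, hnKP, d, hdy, hd⟩ l₀ hl₀ -
    have hn0 : n ≠ 0 := hn.ne_zero
    have hnK : ∀ q ∈ n.primeFactors, Zhang2014.IsKolyvaginPrime (W.conductorNorm ℤ) W K p q ∧
        1 + u ≤ Zhang2014.kolyvaginIndex W p q := fun q hq ↦ hKP q (hnKP q hq)
    have hl₀p : l₀.Prime := Nat.prime_of_mem_primeFactors hl₀
    have hl₀n : l₀ ∣ n := Nat.dvd_of_mem_primeFactors hl₀
    set e₀ : ℤ := εf * (-1) ^ n.primeFactors.card with he₀def
    -- the `λ'` half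
    obtain ⟨ℓ', v', v₀, t, -, hKol', h1u, ⟨hKPℓ', hFℓ'⟩, hℓ'n, hv', hv₀, ht, htv', hxup⟩ :=
      exists_swapPrime_family W τ p e hμ hadd₁ hadd₂ hgal halt hnondeg hτe hK hp2 hττ inv hperf hvan hSC hinv 𝒯
        h𝒯σ h𝒯sd hloc hbot (fun q ↦ KP q ∧ Fine q)
        (fun e₁ he₁ x y hx hy hy0 b ↦ by
          obtain ⟨ℓ, hbℓ, hKPℓ, hFℓ, hord⟩ := hceb e₁ he₁ x y hx hy hy0 b
          exact ⟨ℓ, hbℓ, (hKP ℓ hKPℓ).1, (hKP ℓ hKPℓ).2, ⟨hKPℓ, hFℓ⟩, hord⟩)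
        n hn hnK hl₀ d (hA n d hdy hn hnKP) (hP n d hdy hn hnKP) (hsgn n) (hsign n d hdy hn hnKP)
        (hmin n d hdy hn hnKP) hd
    have hℓ'p : ℓ'.Prime := hKol'.1
    have hℓ'0 : ℓ' ≠ 0 := hℓ'p.ne_zero
    have hℓ'dvd : ¬ ℓ' ∣ n := fun h ↦ hℓ'n (Nat.mem_primeFactors.mpr ⟨hℓ'p, h, hn0⟩)
    -- the swapped conductors and their pool membership
    have hN : Squarefree (n * ℓ') :=
      (Nat.squarefree_mul ((Nat.Prime.coprime_iff_not_dvd hℓ'p).mpr hℓ'dvd).symm).mpr ⟨hn, hℓ'p.squarefree⟩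
    have hNpf : (n * ℓ').primeFactors = n.primeFactors ∪ {ℓ'} := by
      rw [Nat.primeFactors_mul hn0 hℓ'0, hℓ'p.primeFactors]
    have hNKP : ∀ q ∈ (n * ℓ').primeFactors, KP q := by
      intro q hq
      rw [hNpf, Finset.mem_union, Finset.mem_singleton] at hq
      rcases hq with hq | rfl
      · exact hnKP q hq
      · exact hKPℓ'
    have hNcard : (n * ℓ').primeFactors.card = n.primeFactors.card + 1 := by
      rw [hNpf, Finset.card_union_of_disjoint (Finset.disjoint_singleton_right.mpr hℓ'n), Finset.card_singleton]
    have hn'' : Squarefree (n / l₀ * ℓ') := squarefree_swap hn hl₀ hℓ'p hℓ'n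
    have hn''KP : ∀ q ∈ (n / l₀ * ℓ').primeFactors, KP q := by
      intro q hq
      rw [primeFactors_swap hn hl₀ hℓ'p, Finset.mem_insert, Finset.mem_erase] at hq
      rcases hq with rfl | ⟨-, hq⟩
      · exact hKPℓ'
      · exact hnKP q hq
    have hn''eq : n / l₀ * ℓ' * l₀ = n * ℓ' := by rw [mul_right_comm, Nat.div_mul_cancel hl₀n]
    have hl₀'' : ¬ l₀ ∣ n / l₀ * ℓ' := by
      intro h
      have : l₀ * l₀ ∣ n / l₀ * ℓ' * l₀ := by
        rw [mul_comm (n / l₀ * ℓ') l₀]; exact Nat.mul_dvd_mul_left l₀ h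
      rw [hn''eq] at this
      exact hl₀p.one_lt.ne' (Nat.isUnit_iff.mp (hN l₀ this))
    -- presentations at `nℓ'` and `nℓ'/ℓ₀`
    obtain ⟨d', hd'y⟩ := hdata (n * ℓ') hN hNKP
    obtain ⟨d'', hd''y⟩ := hdata (n / l₀ * ℓ') hn'' hn''KP
    -- the sign of `d'` is `−e₀`
    have hκ'sign : conjAct W τ ((p ^ (1 + u) : ℕ) : ℤ) (d'.kolyvaginClass hp (1 + u)) =
        (-e₀) • d'.kolyvaginClass hp (1 + u) := by
      have h := hsign (n * ℓ') d' hd'y hN hNKP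
      have hsignN : εf * (-1) ^ (n * ℓ').primeFactors.card = -e₀ := by rw [hNcard, pow_succ, he₀def]; ring
      rwa [hsignN] at h
    -- the `λ₀` half
    have hres := not_dvd_of_swap_family W τ p e hμ hadd₁ hadd₂ hgal halt hnondeg hτe hK hp2 hττ inv hperf hvan hSC hinv
      𝒯 h𝒯σ h𝒯sd hloc hdisj hbot hn hnK hl₀ hKol' h1u hℓ'n hv' hv₀ d d' d'' hxup (hsgn n) t ht htv'
      (hmin (n * ℓ') d' hd'y hN hNKP) hκ'sign
      (fun Q' hA1' hQ' hQ'P ↦ hsel (n * ℓ') d' hd'y hN hNKP Q' hA1' hQ' hQ'P)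
      (h44 n ℓ' hN hℓ'p hℓ'dvd hNKP d d' hdy hd'y v' hv')
      (addOrderOf_localization_kolyvaginClass_eq_of_family_cast W p ys KP (1 + u) h44 hn''eq hN hl₀p hl₀'' hNKP
        d'' d' hd''y hd'y v₀ hv₀)
    exact ⟨ℓ', hℓ'p, hℓ'n, hFℓ', hn'', hn''KP, d'', hd''y, hres⟩
  -- THE WALK
  obtain ⟨n, ⟨hn, hnKP, d, hdy, hd⟩, hF⟩ :=
    exists_forall_fine_of_swapStep Fine Good (fun n h ↦ h.1) hstep ⟨hn₀, hn₀K, d₀, hd₀y, hd₀⟩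
  exact ⟨n, d, hdy, hn, fun q hq ↦ ⟨hnKP q hq, hF q hq⟩, hd⟩

include halt hnondeg hτe in
/-- **W. Zhang-currency instance of the walk** (appended, g15): pool `KP q := Zhang–Kolyvagin ∧ 1 + u ≤ M(q)`, target `Fine q := m′ ≤ M(q)` —
the GUARDED form (`d.y = ys m` throughout) of the `hswap` shape of tam3-p1's `KolyvaginFamilyData.pDiv_of_swap_of_perLevel` (p592810), modulo the
same displayed inputs with a Čebotarev supply in Zhang's index. CONDITIONAL. [cite: McCallumLMS1991, §5 Prop. 5.2 (p. 304)] [cite: WZhang2014, Notations (xii)] -/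
theorem exists_conductor_levelIndex_ge_of_minDepth_family (hK : IsImaginaryQuadratic K) (hp2 : p ≠ 2) (hττ : τ * τ = 1)
    {ι : K →+* ℂ} (ys : (m : ℕ) → (W.baseChange (ringClassField K ι m)).toAffine.Point)
    (inv : LocalInvariants K (p ^ 1)) (hperf : inv.IsPerfect) (hvan : inv.SumLocalTermEqZero)
    (hSC : inv.SelmerComplement) (hinv : inv.IsConjCompatible τ)
    (𝒯 : SelmerStructure ((W.baseChange K).torsionGaloisModule ((p ^ 1 : ℕ) : ℤ)))
    (h𝒯σ : ∀ (c : ℕ), Squarefree c →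
      (∀ q ∈ c.primeFactors, Zhang2014.IsKolyvaginPrime (W.conductorNorm ℤ) W K p q) →
      ∀ (v w : HeightOneSpectrum (𝓞 K)) (h : τ • v = w), v ∈ placesDividing K c →
      ∀ x : galoisCohomology (((W.baseChange K).torsionGaloisModule ((p ^ 1 : ℕ) : ℤ)).toLocal
        (Sum.inr v : Place K)) 1,
      x ∈ 𝒯 (Sum.inr v) → conjActPlace W τ ((p ^ 1 : ℕ) : ℤ) h x ∈ 𝒯 (Sum.inr w))
    (h𝒯sd : ∀ (c : ℕ), Squarefree c →
      (∀ q ∈ c.primeFactors, Zhang2014.IsKolyvaginPrime (W.conductorNorm ℤ) W K p q) →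
      ∀ v ∈ placesDividing K c,
      inv.dualTransported 𝒯 (weilDualIntertwining (W.baseChange K) (p ^ 1) e hμ hadd₁ hadd₂ hgal)
        (Sum.inr v) = 𝒯 (Sum.inr v))
    (hloc : ∀ ℓ : ℕ, Zhang2014.IsKolyvaginPrime (W.conductorNorm ℤ) W K p ℓ →
      1 ≤ Zhang2014.kolyvaginIndex W p ℓ →
      ∀ (v : HeightOneSpectrum (𝓞 K)), (ℓ : 𝓞 K) ∈ v.asIdeal → ∀ (hfix : τ • v = v) (s : ℤ),
      (s = 1 ∨ s = -1) →
      ((W.baseChange K).kummerSelmerStructure ((p ^ 1 : ℕ) : ℤ) (Sum.inr v)).relIndex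
        ((conjActPlace W τ ((p ^ 1 : ℕ) : ℤ) hfix - s • AddMonoidHom.id _).ker) = p ^ 1)
    (hdisj : ∀ ℓ : ℕ, Zhang2014.IsKolyvaginPrime (W.conductorNorm ℤ) W K p ℓ →
      ∀ v : HeightOneSpectrum (𝓞 K), (ℓ : 𝓞 K) ∈ v.asIdeal →
      Disjoint ((W.baseChange K).kummerSelmerStructure ((p ^ 1 : ℕ) : ℤ) (Sum.inr v)) (𝒯 (Sum.inr v)))
    (hbot : AddSubgroup.torsionBy (W.baseChange K).toAffine.Point (p : ℤ) = ⊥)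
    {u : ℕ} (m' : ℕ)
    -- Čebotarev at level `p` with Zhang's index in the output (kernel: `Koly.exists_kolyvaginPrime_addOrderOf_localization_eq_shift*`)
    (hceb : ∀ (j : ℕ) (e₁ : ℤ), (e₁ = 1 ∨ e₁ = -1) →
      ∀ (x y : galoisCohomology ((W.baseChange K).torsionGaloisModule ((p ^ 1 : ℕ) : ℤ)) 1),
      conjAct W τ ((p ^ 1 : ℕ) : ℤ) x = e₁ • x → conjAct W τ ((p ^ 1 : ℕ) : ℤ) y = (-e₁) • y → y ≠ 0 →
      ∀ (b : ℕ), ∃ ℓ : ℕ, b < ℓ ∧ Zhang2014.IsKolyvaginPrime (W.conductorNorm ℤ) W K p ℓ ∧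
        1 + j ≤ Zhang2014.kolyvaginIndex W p ℓ ∧
        ∀ v : HeightOneSpectrum (𝓞 K), (ℓ : 𝓞 K) ∈ v.asIdeal →
          addOrderOf (galoisCohomology.localization
              ((W.baseChange K).torsionGaloisModule ((p ^ 1 : ℕ) : ℤ)) (Sum.inr v) 1 x) = addOrderOf x ∧
          addOrderOf (galoisCohomology.localization
              ((W.baseChange K).torsionGaloisModule ((p ^ 1 : ℕ) : ℤ)) (Sum.inr v) 1 y) = addOrderOf y)
    (hdata : ∀ (m : ℕ), Squarefree m →
      (∀ q ∈ m.primeFactors, Zhang2014.IsKolyvaginPrime (W.conductorNorm ℤ) W K p q ∧ 1 + u ≤ Zhang2014.kolyvaginIndex W p q) →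
      ∃ dm : KolyvaginFamilyData W K ι m, dm.y = ys m)
    (hA : ∀ (m : ℕ) (dm : KolyvaginFamilyData W K ι m), dm.y = ys m → Squarefree m →
      (∀ q ∈ m.primeFactors, Zhang2014.IsKolyvaginPrime (W.conductorNorm ℤ) W K p q ∧ 1 + u ≤ Zhang2014.kolyvaginIndex W p q) →
      IsAdmissible (absoluteGaloisGroup K) dm.pointsSubgroup ((p ^ (1 + u) : ℕ) : ℤ))
    (hP : ∀ (m : ℕ) (dm : KolyvaginFamilyData W K ι m), dm.y = ys m → Squarefree m →
      (∀ q ∈ m.primeFactors, Zhang2014.IsKolyvaginPrime (W.conductorNorm ℤ) W K p q ∧ 1 + u ≤ Zhang2014.kolyvaginIndex W p q) →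
      dm.toGeomPoints dm.derivedPoint ∈ invPoints (absoluteGaloisGroup K) dm.pointsSubgroup ((p ^ (1 + u) : ℕ) : ℤ))
    {εf : ℤ} (hεf : εf = 1 ∨ εf = -1)
    (hsign : ∀ (m : ℕ) (dm : KolyvaginFamilyData W K ι m), dm.y = ys m → Squarefree m →
      (∀ q ∈ m.primeFactors, Zhang2014.IsKolyvaginPrime (W.conductorNorm ℤ) W K p q ∧ 1 + u ≤ Zhang2014.kolyvaginIndex W p q) →
      conjAct W τ ((p ^ (1 + u) : ℕ) : ℤ) (dm.kolyvaginClass (Fact.out : p.Prime) (1 + u)) =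
        (εf * (-1) ^ m.primeFactors.card) • dm.kolyvaginClass (Fact.out : p.Prime) (1 + u))
    (hsel : ∀ (m : ℕ) (dm : KolyvaginFamilyData W K ι m), dm.y = ys m → Squarefree m →
      (∀ q ∈ m.primeFactors, Zhang2014.IsKolyvaginPrime (W.conductorNorm ℤ) W K p q ∧ 1 + u ≤ Zhang2014.kolyvaginIndex W p q) →
      ∀ (Q : (W.baseChange (ringClassField K ι m)).toAffine.Point)
      (hA1 : IsAdmissible (absoluteGaloisGroup K) dm.pointsSubgroup ((p ^ 1 : ℕ) : ℤ))
      (hQ : dm.toGeomPoints Q ∈ invPoints (absoluteGaloisGroup K) dm.pointsSubgroup ((p ^ 1 : ℕ) : ℤ)),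
      ((p ^ u : ℕ) : ℤ) • Q = dm.derivedPoint →
      kolyvaginClass (W.baseChange K) ((p ^ 1 : ℕ) : ℤ)
          ((W.baseChange K).zsmul_geomPoints_surjective_of_charZero
            (by exact_mod_cast pow_ne_zero 1 (Fact.out : p.Prime).ne_zero)) hA1 (dm.toGeomPoints Q) hQ ∈
        (selmerF W ((p ^ 1 : ℕ) : ℤ) 𝒯 (placesDividing K m)).selmerGroup)
    (h44 : ∀ (m l : ℕ), Squarefree (m * l) → l.Prime → ¬ l ∣ m →
      (∀ q ∈ (m * l).primeFactors, Zhang2014.IsKolyvaginPrime (W.conductorNorm ℤ) W K p q ∧ 1 + u ≤ Zhang2014.kolyvaginIndex W p q) →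
      ∀ (dm : KolyvaginFamilyData W K ι m) (dml : KolyvaginFamilyData W K ι (m * l)),
      dm.y = ys m → dml.y = ys (m * l) →
      ∀ (v : HeightOneSpectrum (𝓞 K)), (l : 𝓞 K) ∈ v.asIdeal →
      addOrderOf ((galoisCohomology.localization
          ((W.baseChange K).torsionGaloisModule ((p ^ (1 + u) : ℕ) : ℤ)) (Sum.inr v) 1 :
            galH1Torsion (W.baseChange K) ((p ^ (1 + u) : ℕ) : ℤ) →+ _)
          (dml.kolyvaginClass (Fact.out : p.Prime) (1 + u))) =
        addOrderOf ((galoisCohomology.localization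
          ((W.baseChange K).torsionGaloisModule ((p ^ (1 + u) : ℕ) : ℤ)) (Sum.inr v) 1 :
            galH1Torsion (W.baseChange K) ((p ^ (1 + u) : ℕ) : ℤ) →+ _)
          (dm.kolyvaginClass (Fact.out : p.Prime) (1 + u))))
    (hmin : ∀ (m : ℕ) (dm : KolyvaginFamilyData W K ι m), dm.y = ys m → Squarefree m →
      (∀ q ∈ m.primeFactors, Zhang2014.IsKolyvaginPrime (W.conductorNorm ℤ) W K p q ∧ 1 + u ≤ Zhang2014.kolyvaginIndex W p q) →
      ∃ Q : (W.baseChange (ringClassField K ι m)).toAffine.Point, ((p ^ u : ℕ) : ℤ) • Q = dm.derivedPoint)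
    {n₀ : ℕ} (hn₀ : Squarefree n₀)
    (hn₀K : ∀ q ∈ n₀.primeFactors, Zhang2014.IsKolyvaginPrime (W.conductorNorm ℤ) W K p q ∧ 1 + u ≤ Zhang2014.kolyvaginIndex W p q)
    (d₀ : KolyvaginFamilyData W K ι n₀) (hd₀y : d₀.y = ys n₀) (hd₀ : ¬ d₀.PDiv p (u + 1)) :
    ∃ (n : ℕ) (d : KolyvaginFamilyData W K ι n), d.y = ys n ∧ Squarefree n ∧
      (∀ q ∈ n.primeFactors, Zhang2014.IsKolyvaginPrime (W.conductorNorm ℤ) W K p q ∧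
        max m' (1 + u) ≤ Zhang2014.kolyvaginIndex W p q) ∧ ¬ d.PDiv p (u + 1) := by
  obtain ⟨n, d, hdy, hn, hF, hnd⟩ := exists_conductor_fine_of_minDepth_family W τ p e hμ hadd₁ hadd₂ hgal halt hnondeg hτe hK
    hp2 hττ ys inv hperf hvan hSC hinv 𝒯 h𝒯σ h𝒯sd hloc hdisj hbot
    (fun q ↦ Zhang2014.IsKolyvaginPrime (W.conductorNorm ℤ) W K p q ∧ 1 + u ≤ Zhang2014.kolyvaginIndex W p q)
    (fun q ↦ max m' (1 + u) ≤ Zhang2014.kolyvaginIndex W p q) (fun q hq ↦ hq)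
    (fun e₁ he₁ x y hx hy hy0 b ↦ by
      obtain ⟨ℓ, hbℓ, hKol, hidx, hord⟩ := hceb (max m' u) e₁ he₁ x y hx hy hy0 b
      exact ⟨ℓ, hbℓ, ⟨hKol, by omega⟩, by omega, hord⟩)
    hdata hA hP hεf hsign hsel h44 hmin hn₀ hn₀K d₀ hd₀y hd₀
  exact ⟨n, d, hdy, hn, fun q hq ↦ ⟨(hF q hq).1.1, (hF q hq).2⟩, hnd⟩

end Prime

end Summit.BirchSwinnertonDyer.Rank1Residual.JET.Swap

end
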